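import Literature.Probability.Percolation.CutClusters
import HarnessLib

/-!
# Cut clusters: transport, measurability, and the counting on `ℤ^d`

Topic `Literature/Probability/Percolation`; theorems only. Continuation of `CutClusters.lean`
(the hub `hubIn ζ B c` of a configuration inside a finite set and the cut-cluster event
`cutClusterAt B c`, replacing the fully open cut-balls of Bollobás–Riordan, *Percolation* (2006),
Ch. 5, proof of Thm. 4, in the Burton–Keane counting argument). Verbatim analogues of the
cut-ball API of `UniquenessInfiniteCluster.lean` / `UniqueClusterDensityBound.lean`:

* `hubIn_relabel`, `relabel_mem_cutClusterAt` — transport along bijections of the vertices;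
* `measurableSet_setOf_hubIn_eq`, `measurableSet_cutClusterAt` — measurability (`V` countable);
* on `ℤ^d`: `cutClusterAt_subset_preimage_shift` (translation covariance),
  `card_filter_cutClusterAt_le` (deterministically at most `|∂ⁱⁿΛ_{N+1}|` cut clusters among
  the `(2m+1)^d` translates `Λ_n(c)`, `c ∈ (2n+2)Λ_m`, `N = (2n+2)m + n`; Bollobás–Riordan 2006,
  pp. 108–109 with hubs in place of balls), `sum_measure_cutClusterAt_le_of_ae_subset` (the
  expected number, for any law carried by lattice configurations),
  `real_cutClusterAt_zero_le_of_invariant` (translation invariance).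

## References

* B. Bollobás, O. Riordan, *Percolation*, Cambridge Univ. Press 2006, Ch. 5, proof of Thm. 4,
  pp. 107–109 of the held copy. [BollobasRiordan2006]

## Mathlib status

No percolation in Mathlib. Anchors: `SimpleGraph.Iso.reachable_iff`, `MeasurableSet.biUnion`,
`MeasureTheory.lintegral_finsetSum`, `MeasurePreserving.measure_preimage`; tree: `hubIn`,
`cutClusterAt`, `isHub_of_mem_cutClusterAt`, `card_add_two_le_card_of_isHub`,
`openClusterIn_relabel`, `relabel_mem_percolatesVia_iff`, `shiftedBox`, `centres`,
`disjoint_shiftedBox_of_ne`, `image_add_box_subset`, `mem_box_succ_of_adj`.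
-/

noncomputable section

namespace Literature.Probability.Percolation

open MeasureTheory SimpleGraph Finset
open Percolation (shiftedBox mem_shiftedBox_iff shiftedBox_zero)
open scoped ENNReal

variable {V W : Type*}

/-! ### Transport along bijections of the vertices -/

/-- A bijection `e` of the vertices carrying `B` onto `e(B)` carries open paths inside `B` to open
paths inside `e(B)`. [folklore] -/
theorem reachable_withinGraph_relabel_iff (e : V ≃ W) (ζ : BondConfig V) (S : Set V) (x y : V) :
    (withinGraph (openGraph (BondConfig.relabel (sym2Equiv e) ζ)) (e '' S)).Reachable (e x) (e y) ↔
      (withinGraph (openGraph ζ) S).Reachable x y := by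
  let φ : withinGraph (openGraph ζ) S ≃g withinGraph (openGraph (BondConfig.relabel (sym2Equiv e) ζ)) (e '' S) :=
    { toEquiv := e
      map_rel_iff' := fun {a b} => by
        simp only [withinGraph_adj]
        rw [openGraph_relabel_adj_iff e ζ a b, e.injective.mem_set_image, e.injective.mem_set_image] }
  exact Iso.reachable_iff (φ := φ)

/-- **Relabelling carries hubs to hubs**: `hubIn (e '' ζ) (e(B)) (e c) = e(hubIn ζ B c)`. [folklore] -/
theorem hubIn_relabel [DecidableEq W] (e : V ≃ W) (ζ : BondConfig V) (B : Finset V) (c : V) :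
    hubIn (BondConfig.relabel (sym2Equiv e) ζ) (B.image e) (e c) = (hubIn ζ B c).image e := by
  ext v'
  simp only [Finset.mem_image, mem_hubIn_iff]
  constructor
  · rintro ⟨⟨v, hv, rfl⟩, hr⟩
    refine ⟨v, ⟨hv, ?_⟩, rfl⟩
    rwa [Finset.coe_image, reachable_withinGraph_relabel_iff] at hr
  · rintro ⟨v, ⟨hv, hr⟩, rfl⟩
    refine ⟨⟨v, hv, rfl⟩, ?_⟩
    rwa [Finset.coe_image, reachable_withinGraph_relabel_iff]

/-- **Cut clusters are transported by bijections of the vertices**: if `ζ` is a cut cluster at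
`c` in `B` then `e '' ζ` is a cut cluster at `e c` in `e(B)`. [folklore] -/
theorem relabel_mem_cutClusterAt [DecidableEq W] (e : V ≃ W) {B : Finset V} {c : V}
    {ζ : BondConfig V} (h : ζ ∈ cutClusterAt B c) :
    BondConfig.relabel (sym2Equiv e) ζ ∈ cutClusterAt (B.image e) (e c) := by
  obtain ⟨w, hwK, hwadj, hwdis, hwperc⟩ := h
  set K := hubIn ζ B c with hK
  have hK' : hubIn (BondConfig.relabel (sym2Equiv e) ζ) (B.image e) (e c) = K.image e :=
    hubIn_relabel e ζ B c
  -- `e` carries the step graph avoiding `K` onto the step graph avoiding `e(K)`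
  have hstep : ∀ u v, (withinGraph ⊤ (↑(K.image e) : Set W)ᶜ).Adj (e u) (e v) ↔
      (withinGraph ⊤ (↑K : Set V)ᶜ).Adj u v := fun u v => by
    simp only [withinGraph_adj, top_adj, ne_eq, Set.mem_compl_iff, Finset.mem_coe,
      e.injective.eq_iff, Function.Injective.mem_finset_image e.injective]
  refine ⟨fun i => e (w i), fun i => ?_, fun i => ?_, fun i j hij => ?_, fun i => ?_⟩
  · rw [hK', Function.Injective.mem_finset_image e.injective]; exact hwK i
  · obtain ⟨k, hk, hadj⟩ := hwadj i
    refine ⟨e k, ?_, (openGraph_relabel_adj_iff e ζ k (w i)).2 hadj⟩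
    rw [hK']; exact Finset.mem_image_of_mem _ hk
  · refine hwdis i j ?_
    change e (w j) ∈ openClusterIn _ _ (e (w i)) at hij
    rw [hK', openClusterIn_relabel e hstep ζ (w i), e.injective.mem_set_image] at hij
    exact hij
  · rw [hK']
    exact (relabel_mem_percolatesVia_iff e hstep ζ (w i)).2 (hwperc i)

/-! ### Measurability -/

/-- The event "the hub is the given set `K ⊆ B`" is measurable. [folklore] -/
theorem measurableSet_setOf_hubIn_eq [Countable V] (B K : Finset V) (c : V) :
    MeasurableSet {ζ : BondConfig V | hubIn ζ B c = K} := by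
  classical
  by_cases hKB : K ⊆ B
  · have heq : {ζ : BondConfig V | hubIn ζ B c = K} =
        ⋂ v ∈ B, {ζ | v ∈ K ↔ ζ ∈ openConnVia (withinGraph ⊤ (↑B : Set V)) c v} := by
      ext ζ
      simp only [Set.mem_setOf_eq, Set.mem_iInter]
      constructor
      · intro h v hv
        rw [← h, mem_hubIn_iff']
        exact ⟨fun h' => h'.2, fun h' => ⟨hv, h'⟩⟩
      · intro h
        ext v
        rw [mem_hubIn_iff']
        constructor
        · rintro ⟨hv, hc⟩; exact (h v hv).2 hc
        · intro hv; exact ⟨hKB hv, (h v (hKB hv)).1 hv⟩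
    rw [heq]
    refine MeasurableSet.biInter B.countable_toSet fun v _ => ?_
    by_cases hv : v ∈ K
    · simp only [hv, true_iff]
      exact measurableSet_openConnVia _ c v
    · simp only [hv, false_iff]
      exact (measurableSet_openConnVia _ c v).compl
  · have heq : {ζ : BondConfig V | hubIn ζ B c = K} = ∅ := by
      ext ζ
      simp only [Set.mem_setOf_eq, Set.mem_empty_iff_false, iff_false]
      intro h
      exact hKB (h ▸ hubIn_subset ζ B c)
    rw [heq]
    exact MeasurableSet.empty

/-- The cut-cluster event is measurable (`V` countable): split along the finitely many possible
hubs `K ⊆ B`; for fixed `K` the branch conditions are countably many measurable conditions on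
the states of edges. [folklore] -/
theorem measurableSet_cutClusterAt [Countable V] (B : Finset V) (c : V) :
    MeasurableSet (cutClusterAt B c : Set (BondConfig V)) := by
  classical
  -- the branch event for a fixed hub `K`
  set Br : Finset V → Set (BondConfig V) := fun K =>
    ⋃ w : Fin 3 → V, ((⋂ i, {_ω | w i ∉ K}) ∩
      (⋂ i, ⋃ k ∈ K, {ω : BondConfig V | s(k, w i) ∈ ω ∧ k ≠ w i}) ∩
      (⋂ i, ⋂ j, {_ω | i = j} ∪ (openConnVia (withinGraph ⊤ (↑K : Set V)ᶜ) (w i) (w j))ᶜ) ∩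
      (⋂ i, percolatesVia (withinGraph ⊤ (↑K : Set V)ᶜ) (w i))) with hBr
  have hBrm : ∀ K, MeasurableSet (Br K) := fun K =>
    MeasurableSet.iUnion fun w => (((MeasurableSet.iInter fun i => MeasurableSet.const _).inter
      (MeasurableSet.iInter fun i => MeasurableSet.biUnion (Finset.countable_toSet _)
        fun k _ => (measurableSet_mem _).inter (MeasurableSet.const _))).inter
      (MeasurableSet.iInter fun i => MeasurableSet.iInter fun j => (MeasurableSet.const _).union
        (measurableSet_openConnVia _ (w i) (w j)).compl)).inter
      (MeasurableSet.iInter fun i => measurableSet_percolatesVia _ (w i))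
  have hmemBr : ∀ (K : Finset V) (ζ : BondConfig V), ζ ∈ Br K ↔
      ∃ w : Fin 3 → V, (∀ i, w i ∉ K) ∧ (∀ i, ∃ k ∈ K, (openGraph ζ).Adj k (w i)) ∧
        (∀ i j, ζ ∈ openConnVia (withinGraph ⊤ (↑K : Set V)ᶜ) (w i) (w j) → i = j) ∧
        ∀ i, ζ ∈ percolatesVia (withinGraph ⊤ (↑K : Set V)ᶜ) (w i) := by
    intro K ζ
    simp only [hBr, Set.mem_iUnion, Set.mem_inter_iff, Set.mem_iInter, Set.mem_setOf_eq,
      Set.mem_union, Set.mem_compl_iff, exists_prop, openGraph_adj]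
    constructor
    · rintro ⟨w, ⟨⟨h1, h2⟩, h3⟩, h4⟩
      refine ⟨w, h1, h2, fun i j h => ?_, h4⟩
      rcases h3 i j with hij | hij
      · exact hij
      · exact absurd h hij
    · rintro ⟨w, h1, h2, h3, h4⟩
      refine ⟨w, ⟨⟨h1, h2⟩, fun i j => ?_⟩, h4⟩
      by_cases hij : i = j
      · exact Or.inl hij
      · exact Or.inr fun h => hij (h3 i j h)
  have heq : (cutClusterAt B c : Set (BondConfig V)) =
      ⋃ K ∈ B.powerset, ({ζ | hubIn ζ B c = K} ∩ Br K) := by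
    ext ζ
    simp only [Set.mem_iUnion, Set.mem_inter_iff, Set.mem_setOf_eq, exists_prop,
      Finset.mem_powerset]
    constructor
    · intro h
      exact ⟨hubIn ζ B c, hubIn_subset ζ B c, rfl, (hmemBr _ ζ).2 h⟩
    · rintro ⟨K, -, hK, h⟩
      have h' := (hmemBr K ζ).1 h
      rw [← hK] at h'
      exact h'
  rw [heq]
  exact MeasurableSet.biUnion (Finset.countable_toSet _) fun K _ =>
    (measurableSet_setOf_hubIn_eq B K c).inter (hBrm K)

/-! ### Cut clusters on `ℤ^d`: translation covariance and counting -/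

section Lattice

variable {d : ℕ}

/-- Translating a configuration by `v` carries the cut-cluster event at centre `c` (in
`Λ_n(c)`) into the cut-cluster event at centre `c + v` (in `Λ_n(c + v)`). [folklore] -/
theorem cutClusterAt_subset_preimage_shift (c v : LatticeModels.Site d) (n : ℕ) :
    cutClusterAt (shiftedBox c n) c ⊆
      BondConfig.relabel (sym2Equiv (LatticeModels.Site.shift v)) ⁻¹' cutClusterAt (shiftedBox (c + v) n) (c + v) := by
  intro ζ hζ
  have h := relabel_mem_cutClusterAt (LatticeModels.Site.shift v) hζ
  have hbox : (shiftedBox c n).image (LatticeModels.Site.shift v) = shiftedBox (c + v) n := by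
    rw [← shiftedBox_image_add]; rfl
  rw [hbox] at h
  exact h

/-- The hub of `Λ_n(c)` contains `c` and lies in `Λ_n(c)`; hubs of distinct good centres of the
grid `(2n+2)Λ_m` are therefore distinct and disjoint. [folklore] -/
theorem disjoint_hubIn_shiftedBox_of_ne {n : ℕ} {j j' : LatticeModels.Site d} (h : j ≠ j') (ζ : BondConfig (LatticeModels.Site d)) :
    Disjoint (hubIn ζ (shiftedBox ((2 * n + 2 : ℤ) • j) n) ((2 * n + 2 : ℤ) • j))
      (hubIn ζ (shiftedBox ((2 * n + 2 : ℤ) • j') n) ((2 * n + 2 : ℤ) • j')) :=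
  (disjoint_shiftedBox_of_ne h).mono (hubIn_subset _ _ _) (hubIn_subset _ _ _)

open Classical in
/-- **Deterministic bound on the number of cut clusters** (Bollobás–Riordan 2006, Ch. 5,
pp. 108–109, with hubs in place of cut-balls): for a configuration `ζ ⊆ E(ℤ^d)`, the number of
centres `c ∈ (2n+2)Λ_m` at which the cut-cluster event in `Λ_n(c)` occurs is at most
`|∂ⁱⁿΛ_{N+1}|`, `N = (2n+2)m + n`: the hubs are pairwise disjoint hubs of the open graph of
`Λ_{N+1}` relative to `∂ⁱⁿΛ_{N+1}` (`isHub_of_mem_cutClusterAt`), and the counting lemma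
`card_add_two_le_card_of_isHub` applies. [cite: BollobasRiordan2006, Ch. 5, proof of Thm. 4 (pp. 108–109)] -/
theorem card_filter_cutClusterAt_le (n m : ℕ) {ζ : BondConfig (LatticeModels.Site d)} (hζG : ζ ⊆ (LatticeModels.zdGraph d).edgeSet) :
    ((centres n m).filter fun c => ζ ∈ cutClusterAt (shiftedBox c n) c).card ≤
      (LatticeModels.innerBoundary (LatticeModels.zdGraph d) (LatticeModels.box d ((2 * n + 2) * m + n + 1))).card := by
  classical
  set N := (2 * n + 2) * m + n with hN
  set Wc := (centres n m).filter fun c => ζ ∈ cutClusterAt (shiftedBox c n) c with hWc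
  set 𝓚 : Finset (Finset (LatticeModels.Site d)) := Wc.image fun c => hubIn ζ (shiftedBox c n) c with h𝓚
  have hcard : 𝓚.card = Wc.card := by
    refine Finset.card_image_of_injOn fun c hc c' hc' hcc' => ?_
    obtain ⟨j, -, rfl⟩ := Finset.mem_image.1 (Finset.mem_filter.1 hc).1
    obtain ⟨j', -, rfl⟩ := Finset.mem_image.1 (Finset.mem_filter.1 hc').1
    by_contra hne
    have hjj' : j ≠ j' := fun h => hne (by rw [h])
    have hdis := disjoint_hubIn_shiftedBox_of_ne (n := n) hjj' ζ
    have hmem : (2 * n + 2 : ℤ) • j ∈ hubIn ζ (shiftedBox ((2 * n + 2 : ℤ) • j) n) ((2 * n + 2 : ℤ) • j) :=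
      self_mem_hubIn (self_mem_shiftedBox _ n) ζ
    have hmem' : (2 * n + 2 : ℤ) • j ∈ hubIn ζ (shiftedBox ((2 * n + 2 : ℤ) • j') n) ((2 * n + 2 : ℤ) • j') := by
      have := hcc' ▸ hmem; exact this
    exact Finset.disjoint_left.1 hdis hmem hmem'
  rcases Wc.eq_empty_or_nonempty with hW | hW
  · rw [hW]; simp
  have hne : 𝓚.Nonempty := by rwa [h𝓚, Finset.image_nonempty]
  rw [← hcard]
  refine le_trans (Nat.le_add_right _ 2) (card_add_two_le_card_of_isHub
    (withinGraph (openGraph ζ) ↑(LatticeModels.box d (N + 1))) _ 𝓚 hne ?_ ?_)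
  · -- distinct hubs are disjoint
    intro K hK K' hK' hKK'
    obtain ⟨c, hc, rfl⟩ := Finset.mem_image.1 hK
    obtain ⟨c', hc', rfl⟩ := Finset.mem_image.1 hK'
    obtain ⟨j, -, rfl⟩ := Finset.mem_image.1 (Finset.mem_filter.1 hc).1
    obtain ⟨j', -, rfl⟩ := Finset.mem_image.1 (Finset.mem_filter.1 hc').1
    exact disjoint_hubIn_shiftedBox_of_ne (fun h => hKK' (by rw [h])) ζ
  · -- each cut cluster is a hub
    intro K hK
    obtain ⟨c, hc, rfl⟩ := Finset.mem_image.1 hK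
    obtain ⟨hcW, hcut⟩ := Finset.mem_filter.1 hc
    have hcbox : c ∈ LatticeModels.box d ((2 * n + 2) * m) := centres_subset_box n m hcW
    have hKN : shiftedBox c n ⊆ LatticeModels.box d N := fun x hx =>
      image_add_box_subset hcbox (Finset.mem_image.2 ⟨x - c, mem_shiftedBox_iff.1 hx, sub_add_cancel x c⟩)
    refine isHub_of_mem_cutClusterAt hcut hζG (self_mem_shiftedBox c n)
      (hKN.trans (LatticeModels.box_mono d (Nat.le_succ N))) (fun k hk v hkv => ?_)
    exact mem_box_succ_of_adj (hKN hk) hkv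

/-- The expected number of cut clusters among the centres is at most `|∂ⁱⁿΛ_{N+1}|`, for any
probability measure carried by nearest-neighbour configurations (Bollobás–Riordan 2006, Ch. 5,
p. 108: linearity of expectation against the deterministic bound). [cite: BollobasRiordan2006, Ch. 5, proof of Thm. 4 (p. 108)] -/
theorem sum_measure_cutClusterAt_le_of_ae_subset (μ : Measure (BondConfig (LatticeModels.Site d))) [IsProbabilityMeasure μ]
    (hS : ∀ᵐ ω ∂μ, ω ⊆ (LatticeModels.zdGraph d).edgeSet) (n m : ℕ) :
    ∑ c ∈ centres n m, μ (cutClusterAt (shiftedBox c n) c) ≤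
      (LatticeModels.innerBoundary (LatticeModels.zdGraph d) (LatticeModels.box d ((2 * n + 2) * m + n + 1))).card := by
  classical
  set L := LatticeModels.innerBoundary (LatticeModels.zdGraph d) (LatticeModels.box d ((2 * n + 2) * m + n + 1)) with hL
  have h1 : ∑ c ∈ centres n m, μ (cutClusterAt (shiftedBox c n) c) =
      ∫⁻ ω, ∑ c ∈ centres n m, (cutClusterAt (shiftedBox c n) c).indicator 1 ω ∂μ := by
    rw [lintegral_finsetSum _ fun c _ => measurable_one.indicator (measurableSet_cutClusterAt _ c)]
    exact Finset.sum_congr rfl fun c _ => (lintegral_indicator_one (measurableSet_cutClusterAt _ c)).symm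
  calc ∑ c ∈ centres n m, μ (cutClusterAt (shiftedBox c n) c)
        = ∫⁻ ω, ∑ c ∈ centres n m, (cutClusterAt (shiftedBox c n) c).indicator 1 ω ∂μ := h1
    _ ≤ ∫⁻ _ω, (L.card : ℝ≥0∞) ∂μ := by
        refine lintegral_mono_ae ?_
        filter_upwards [hS] with ω hω
        have hsum : ∑ c ∈ centres n m, (cutClusterAt (shiftedBox c n) c).indicator (1 : BondConfig (LatticeModels.Site d) → ℝ≥0∞) ω =
            (((centres n m).filter fun c => ω ∈ cutClusterAt (shiftedBox c n) c).card : ℝ≥0∞) := by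
          simp only [Set.indicator_apply, Pi.one_apply]
          rw [Finset.sum_boole]
        rw [hsum]
        exact_mod_cast card_filter_cutClusterAt_le n m hω
    _ = L.card := by rw [lintegral_const, measure_univ, mul_one]

/-- Translation invariance carries the cut-cluster probability from the origin to any centre:
`μ(T'_n(0)) ≤ μ(T'_n(c))` for a translation-invariant measure. [folklore] -/
theorem real_cutClusterAt_zero_le_of_invariant (μ : Measure (BondConfig (LatticeModels.Site d))) [IsFiniteMeasure μ]
    (hT : ∀ v : LatticeModels.Site d, MeasurePreserving (BondConfig.relabel (sym2Equiv (LatticeModels.Site.shift v))) μ μ)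
    (c : LatticeModels.Site d) (n : ℕ) :
    μ.real (cutClusterAt (shiftedBox 0 n) 0) ≤ μ.real (cutClusterAt (shiftedBox c n) c) := by
  have h := (hT c).measure_preimage (measurableSet_cutClusterAt (shiftedBox c n) c).nullMeasurableSet
  have h' : μ.real (BondConfig.relabel (sym2Equiv (LatticeModels.Site.shift c)) ⁻¹' cutClusterAt (shiftedBox c n) c) =
      μ.real (cutClusterAt (shiftedBox c n) c) := by
    rw [measureReal_def, measureReal_def, h]
  rw [← h']
  exact measureReal_mono (by simpa using cutClusterAt_subset_preimage_shift (0 : LatticeModels.Site d) c n)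

end Lattice

end Literature.Probability.Percolation

end
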